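import Summits.HodgeConjecture.HodgeConjecture.Theorems.F0P3cStCharTSHShellGlue         -- ★ p849770 «HSHELL-GLUE★» (this seat): `hshell_of_twoCoset` (consumer of `htwo`); brings LevelFamily ∕ SurjHecke ∕ ChartIso ∕ TorusDefs
import Summits.HodgeConjecture.HodgeConjecture.Theorems.F0P3cStCharTSVanDijkWeylSymm     -- ★ «VDW-SYMM★» (LH6-p02 g2): `vanDijkWeight_eq_of_isUnit`, `vanDijkWeight_eq_zero_of_not`
import Summits.HodgeConjecture.HodgeConjecture.Theorems.F0P3cStCharTSShellWeight       -- ★ p849808 «SHELL-WEIGHT★» (LH1-p03 g2): `vanDijkWeight_torusChart_ne_zero` (`Δ(ι m) ≠ 0` off `M_c`)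
import HarnessLib

/-!
# F0 · P3c · line LH6 «StCharTS» — «HTWO-OF-PSI★»: the two-coset identity `Δ·O^{can} = κ·(𝟙 + 𝟙)` on ALL of `M_T` from the PRODUCER `Ψ` of road (D)'s D3-ii-G
# (★ p849606's conclusion `Ψ = κ_G·(𝟙_{b₁C} + 𝟙_{b₂C})` + the Ψ-producer's pointwise clause + «`Δ ≠ 0` off `M_c`»)
# [Rogawski1990, §12.7 L. 12.7.2 (proof) pp. 193–194; §4.9 (4.9.4) p. 56]

Cell `pub/hodgecm-mathlib`, crux H413 = `stmt-HodgeConjecture-24833` (`--supports` lane, helper), route HCCMUnconditional; seat LH6-p05 (g2); DEFAULT after KNOCK 06:3xZ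
(road (D) owner LH6-p03 (g0); (TOR) integrator LH6-p01 (g2)).  THEOREMS ONLY, sorry-free, no definition ∕ instance ∕ notation ∕ named fact.
THE LAST BOOKKEEPING LINK of the (SHF′) chain: road (D) delivers (i) ★ p849606 `normalizedOrbitalIntegral_eq_twoCoset`: `Ψ = κ_G·(𝟙_{b₁C_T} + κ𝟙_{b₂C_T})` on `M_T`, (ii) the
Ψ-producer's POINTWISE clause «`Ψ t = δ_B^{1∕2}(t)·J₃(t,d)⁻¹·O^{can}_t(φ)` for every `t` and every diagonal writing `d` off the walls», (iii) ★ «SHELL-WEIGHT★» p849808 (LH1-p03):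
`Δ(ι m) ≠ 0` for `m ∉ M_c` (DISCHARGED here, not a binder).  At the identity frame, with `b₁ = ι u`, `b₂ = ι(ω u)`, `κ = 1` and a level `C_T` with `ι⁻¹(C_T) ≤ M_c`, these give the hypothesis `htwo`
of ★ p849770 `hshell_of_twoCoset`:  `Δ(t)·O^{can}_t(φ) = κ_G·(𝟙_{ι(u)C_T}(t) + 𝟙_{ι(ω u)C_T}(t))` for EVERY `t ∈ M_T` — on the regular `dite`-locus `Δ = δ^{1∕2}J₃⁻¹` (★
`vanDijkWeight_eq_of_isUnit`) and the pointwise clause; off it `Δ = 0` (★ `vanDijkWeight_eq_zero_of_not`) and both cosets are missed (they avoid `M_c`, where alone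
`Δ` may vanish).
* `not_mem_torusCompactPart_of_mem_smul`, `reflect_not_mem_torusCompactPart` — coset∕`ω` bookkeeping against `M_c`;
* **`htwo_of_psi`** — the statement above; **`hshell_of_psi`** — composed with ★ p849770: the `hshell` clause of ★ p849745 from (i)(ii)(iii) + smooth `φ` supported in
  `hyperbolicSet` + `κ_G ≠ 0`.
HONEST LABEL: HC_CM is proved only modulo the 7 printed citations (2 remaining: hLiu418 = stmt-HodgeConjecture-24832, h413 = stmt-HodgeConjecture-24833) until rung 0
closes; count-neutral.

## References
* [Rogawski1990] J. D. Rogawski, *Automorphic Representations of Unitary Groups in Three Variables*, Ann. of Math. Stud. 123 (1990): §4.9 (4.9.4) p. 56; §12.5 p. 183;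
  §12.7 L. 12.7.2 (proof) pp. 193–194.
-/

set_option autoImplicit false
-- the mandated namespace has the single-problem summit's repeated segment (`HodgeConjecture.HodgeConjecture`)
set_option linter.dupNamespace false

noncomputable section

open NumberField IsDedekindDomain MeasureTheory Measure Topology Filter
open scoped NNReal ENNReal Pointwise MatrixGroups
open Literature.NumberTheory.Rogawski1990 Literature.NumberTheory.Automorphic Literature.NumberTheory.Automorphic.UnitaryGroup

namespace Summit.HodgeConjecture.HodgeConjecture.Cruxes.H413.F0P3cStCharTSHTwoOfPsi

variable (L : Type) [Field L] [NumberField L] [IsCMField L] (v : HeightOneSpectrum (𝓞 ↥(maximalRealSubfield L)))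

/-! ## §1 Cosets off `M_c` -/

/-- A coset `x·C` with `x ∉ M_c` and `C ≤ M_c` misses `M_c`. [cite: Rogawski1990, §12.7 L. 12.7.1 (proof) p. 191] -/
theorem not_mem_torusCompactPart_of_mem_smul {C : Subgroup ((UnitaryGroup.LocalRing L v)ˣ × ↥(normOneUnits (conjLocal L (IsCMField.complexConj L) v)))} (hCle : C ≤ (((Submonoid.pi Set.univ (fun w : PlacesOver L v => (w.1.adicCompletionIntegers L).toSubring.toSubmonoid)).units.prod (⊤ : Subgroup ↥(normOneUnits (conjLocal L (IsCMField.complexConj L) v)))) : Subgroup ((UnitaryGroup.LocalRing L v)ˣ × ↥(normOneUnits (conjLocal L (IsCMField.complexConj L) v))))) {x m : ((UnitaryGroup.LocalRing L v)ˣ × ↥(normOneUnits (conjLocal L (IsCMField.complexConj L) v)))}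
    (hx : x ∉ (((Submonoid.pi Set.univ (fun w : PlacesOver L v => (w.1.adicCompletionIntegers L).toSubring.toSubmonoid)).units.prod (⊤ : Subgroup ↥(normOneUnits (conjLocal L (IsCMField.complexConj L) v)))) : Subgroup ((UnitaryGroup.LocalRing L v)ˣ × ↥(normOneUnits (conjLocal L (IsCMField.complexConj L) v))))) (hm : m ∈ x • (C : Set ((UnitaryGroup.LocalRing L v)ˣ × ↥(normOneUnits (conjLocal L (IsCMField.complexConj L) v))))) : m ∉ (((Submonoid.pi Set.univ (fun w : PlacesOver L v => (w.1.adicCompletionIntegers L).toSubring.toSubmonoid)).units.prod (⊤ : Subgroup ↥(normOneUnits (conjLocal L (IsCMField.complexConj L) v)))) : Subgroup ((UnitaryGroup.LocalRing L v)ˣ × ↥(normOneUnits (conjLocal L (IsCMField.complexConj L) v)))) := by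
  obtain ⟨c, hc, rfl⟩ := hm
  intro h
  refine hx ?_
  have h' : x = x * c * c⁻¹ := by rw [mul_inv_cancel_right]
  rw [h']
  exact Subgroup.mul_mem _ h (Subgroup.inv_mem _ (hCle hc))

/-- `x ∉ M_c ⇒ ω x ∉ M_c` (non-split `v`; `ω` is an involution preserving `M_c`, ★ `reflect_mem_torusCompactPart`). [cite: Rogawski1990, §12.2 p. 173] -/
theorem reflect_not_mem_torusCompactPart (hns : ∀ w : PlacesOver L v, IsCMField.complexConj L • w.1 = w.1) {x : ((UnitaryGroup.LocalRing L v)ˣ × ↥(normOneUnits (conjLocal L (IsCMField.complexConj L) v)))}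
    (hx : x ∉ (((Submonoid.pi Set.univ (fun w : PlacesOver L v => (w.1.adicCompletionIntegers L).toSubring.toSubmonoid)).units.prod (⊤ : Subgroup ↥(normOneUnits (conjLocal L (IsCMField.complexConj L) v)))) : Subgroup ((UnitaryGroup.LocalRing L v)ˣ × ↥(normOneUnits (conjLocal L (IsCMField.complexConj L) v))))) : (fun p : ((UnitaryGroup.LocalRing L v)ˣ × ↥(normOneUnits (conjLocal L (IsCMField.complexConj L) v))) => ((Units.map ((conjLocal L (IsCMField.complexConj L) v : UnitaryGroup.LocalRing L v →+* UnitaryGroup.LocalRing L v) : UnitaryGroup.LocalRing L v →* UnitaryGroup.LocalRing L v) p.1)⁻¹, p.2)) x ∉ (((Submonoid.pi Set.univ (fun w : PlacesOver L v => (w.1.adicCompletionIntegers L).toSubring.toSubmonoid)).units.prod (⊤ : Subgroup ↥(normOneUnits (conjLocal L (IsCMField.complexConj L) v)))) : Subgroup ((UnitaryGroup.LocalRing L v)ˣ × ↥(normOneUnits (conjLocal L (IsCMField.complexConj L) v)))) := by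
  intro h
  have h2 := F0P3cStCharTSTorusCompactPart.reflect_mem_torusCompactPart L v hns _ h
  have hωω := F0P3cStCharTSTorusRay.reflect_reflect L v x
  simp only at hωω h2
  rw [hωω] at h2
  exact hx h2

/-! ## §2 `htwo` from the producer `Ψ` -/

set_option maxHeartbeats 400000 in
/-- **«HTWO-OF-PSI★»: the two-coset identity for `Δ·O^{can}` on all of `M_T`.**  Hypotheses (identity frame of `Gqs L v`): a level `C_T ≤ M_T` with `ι⁻¹(C_T) ≤ M_c`;
`u ∉ M_c`; the Ψ-producer's POINTWISE clause for `φ` (every `t`, every diagonal writing `d` off the walls); ★ p849606's conclusion in the form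
`Ψ = κ·(𝟙_{ι(u)C_T} + 𝟙_{ι(ω u)C_T})`; «`Δ(ι m) ≠ 0` for `m ∉ M_c`» is ★ «SHELL-WEIGHT★» p849808.  Conclusion = the `htwo` binder of ★ p849770 `hshell_of_twoCoset`.
[cite: Rogawski1990, §12.7 L. 12.7.2 (proof) pp. 193–194; §4.9 (4.9.4) p. 56] -/
theorem htwo_of_psi (hns : ∀ w : PlacesOver L v, IsCMField.complexConj L • w.1 = w.1)
    [MeasurableSpace (Gqs L v)] [∀ γ : Gqs L v, MeasurableSpace (Gqs L v ⧸ Subgroup.centralizer ({γ} : Set (Gqs L v)))]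
    (mQv : OrbitalMeasureFamily (Gqs L v))
    (CT : Subgroup ↥(cmBorelTriple L 3 v).M) (hCle : (CT.comap (F0P3cStCharTSTorusDefs.torusChartHom L v) : Subgroup ((UnitaryGroup.LocalRing L v)ˣ × ↥(normOneUnits (conjLocal L (IsCMField.complexConj L) v)))) ≤ (((Submonoid.pi Set.univ (fun w : PlacesOver L v => (w.1.adicCompletionIntegers L).toSubring.toSubmonoid)).units.prod (⊤ : Subgroup ↥(normOneUnits (conjLocal L (IsCMField.complexConj L) v)))) : Subgroup ((UnitaryGroup.LocalRing L v)ˣ × ↥(normOneUnits (conjLocal L (IsCMField.complexConj L) v)))))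
    (u : ((UnitaryGroup.LocalRing L v)ˣ × ↥(normOneUnits (conjLocal L (IsCMField.complexConj L) v)))) (hu : u ∉ (((Submonoid.pi Set.univ (fun w : PlacesOver L v => (w.1.adicCompletionIntegers L).toSubring.toSubmonoid)).units.prod (⊤ : Subgroup ↥(normOneUnits (conjLocal L (IsCMField.complexConj L) v)))) : Subgroup ((UnitaryGroup.LocalRing L v)ˣ × ↥(normOneUnits (conjLocal L (IsCMField.complexConj L) v))))) (φ : Gqs L v → ℂ) (Ψ : ↥(cmBorelTriple L 3 v).M → ℂ) (κ : ℂ)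
    (hΨpt : haveI := locallyCompactSpace_cmBorelU L 3 v
      ∀ (t : ↥(cmBorelTriple L 3 v).M) (d : Fin 3 → (LocalRing L v)ˣ)
      (hd : glDiagonal 3 (LocalRing L v) d =
        ((t : ↥(unitaryGroupOfForm (conjLocal L (IsCMField.complexConj L) v) (cmLocalForm L 3 v))) : GL (Fin 3) (LocalRing L v)))
      (ha' : IsUnit ((((d 0)⁻¹ * d 1 : (LocalRing L v)ˣ) : LocalRing L v) - 1))
      (hb' : IsUnit ((((d 0)⁻¹ * d 2 : (LocalRing L v)ˣ) : LocalRing L v) - 1)),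
      Ψ t =
          ((rootDeltaChar (cmBorelTriple L 3 v).P
            ⟨(t : ↥(unitaryGroupOfForm (conjLocal L (IsCMField.complexConj L) v) (cmLocalForm L 3 v))), (cmBorelTriple L 3 v).M_le t.2⟩ : ℂˣ) : ℂ) *
        (((letI : MeasurableSpace (LocalRing L v) := borel _; haveI : BorelSpace (LocalRing L v) := ⟨rfl⟩
          haveI : SecondCountableTopology (LocalRing L v) := secondCountableTopology_localRing (E := L) v
          ((distribHaarChar (LocalRing L v) ha'.unit)⁻¹ *
            (HeisRing.skewModulus (conjLocal L (IsCMField.complexConj L) v) (continuous_conjLocal L (IsCMField.complexConj L) v) hb'.unit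
              (HeisRing.map_unit_torusCentralScalar_sub_one (conjLocal L (IsCMField.complexConj L) v) (cmLocalForm_eq_over L 3 v) t hd hb'))⁻¹ :
                ℝ≥0)) : ℝ) : ℂ)⁻¹ *
        classOrbitalIntegral mQv φ
          (ConjClasses.mk ((t : ↥(unitaryGroupOfForm (conjLocal L (IsCMField.complexConj L) v) (cmLocalForm L 3 v))) : Gqs L v)))
    (hΨtwo : Ψ = fun t => κ * ({t' : ↥(cmBorelTriple L 3 v).M | (F0P3cStCharTSTorusDefs.torusChart L v u)⁻¹ * t' ∈ (CT : Set ↥(cmBorelTriple L 3 v).M)}.indicator (fun _ => (1 : ℂ)) t +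
        {t' : ↥(cmBorelTriple L 3 v).M | (F0P3cStCharTSTorusDefs.torusChart L v ((fun p : ((UnitaryGroup.LocalRing L v)ˣ × ↥(normOneUnits (conjLocal L (IsCMField.complexConj L) v))) => ((Units.map ((conjLocal L (IsCMField.complexConj L) v : UnitaryGroup.LocalRing L v →+* UnitaryGroup.LocalRing L v) : UnitaryGroup.LocalRing L v →* UnitaryGroup.LocalRing L v) p.1)⁻¹, p.2)) u))⁻¹ * t' ∈ (CT : Set ↥(cmBorelTriple L 3 v).M)}.indicator (fun _ => (1 : ℂ)) t)) :
    ∀ t : ↥(cmBorelTriple L 3 v).M,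
      F0P3cStCharTSTorusDefs.vanDijkWeight L v t *
          classOrbitalIntegral mQv φ (ConjClasses.mk (((t : ↥(cmBorelTriple L 3 v).M) :
            ↥(unitaryGroupOfForm (conjLocal L (IsCMField.complexConj L) v) (cmLocalForm L 3 v))) : Gqs L v)) =
        κ * ({t' : ↥(cmBorelTriple L 3 v).M | (F0P3cStCharTSTorusDefs.torusChart L v u)⁻¹ * t' ∈ (CT : Set ↥(cmBorelTriple L 3 v).M)}.indicator (fun _ => (1 : ℂ)) t +
          {t' : ↥(cmBorelTriple L 3 v).M | (F0P3cStCharTSTorusDefs.torusChart L v ((fun p : ((UnitaryGroup.LocalRing L v)ˣ × ↥(normOneUnits (conjLocal L (IsCMField.complexConj L) v))) => ((Units.map ((conjLocal L (IsCMField.complexConj L) v : UnitaryGroup.LocalRing L v →+* UnitaryGroup.LocalRing L v) : UnitaryGroup.LocalRing L v →* UnitaryGroup.LocalRing L v) p.1)⁻¹, p.2)) u))⁻¹ * t' ∈ (CT : Set ↥(cmBorelTriple L 3 v).M)}.indicator (fun _ => (1 : ℂ)) t) := by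
  intro t
  have htwo_t := congrFun hΨtwo t
  simp only at htwo_t
  by_cases hc : IsUnit ((((torusEntry (conjLocal L (IsCMField.complexConj L) v) (cmLocalForm L 3 v) 0 t)⁻¹ *
        torusEntry (conjLocal L (IsCMField.complexConj L) v) (cmLocalForm L 3 v) 1 t : (LocalRing L v)ˣ) : LocalRing L v) - 1) ∧
      IsUnit ((((torusEntry (conjLocal L (IsCMField.complexConj L) v) (cmLocalForm L 3 v) 0 t)⁻¹ *
        torusEntry (conjLocal L (IsCMField.complexConj L) v) (cmLocalForm L 3 v) 2 t : (LocalRing L v)ˣ) : LocalRing L v) - 1)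
  · -- on the regular locus: `Δ = δ J⁻¹` and the pointwise clause
    have h1 := hΨpt t (fun i => torusEntry (conjLocal L (IsCMField.complexConj L) v) (cmLocalForm L 3 v) i t)
      (F0P3cStCharTSTorusDefs.glDiagonal_torusEntry L v t) hc.1 hc.2
    beta_reduce at h1
    rw [F0P3cStCharTSVanDijkWeylSymm.vanDijkWeight_eq_of_isUnit L v t hc.1 hc.2]
    exact h1.symm.trans htwo_t
  · -- off it: `Δ = 0`, and `t` lies in neither coset (both cosets avoid `M_c`, where alone `Δ` vanishes)
    rw [F0P3cStCharTSVanDijkWeylSymm.vanDijkWeight_eq_zero_of_not L v t hc, zero_mul]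
    have hΔ0 : F0P3cStCharTSTorusDefs.vanDijkWeight L v t = 0 := F0P3cStCharTSVanDijkWeylSymm.vanDijkWeight_eq_zero_of_not L v t hc
    -- write `t = ι m`
    obtain ⟨m, rfl⟩ := (F0P3cStCharTSTorusChartIso.torusChart_bijective L v).2 t
    have hωu : (fun p : ((UnitaryGroup.LocalRing L v)ˣ × ↥(normOneUnits (conjLocal L (IsCMField.complexConj L) v))) => ((Units.map ((conjLocal L (IsCMField.complexConj L) v : UnitaryGroup.LocalRing L v →+* UnitaryGroup.LocalRing L v) : UnitaryGroup.LocalRing L v →* UnitaryGroup.LocalRing L v) p.1)⁻¹, p.2)) u ∉ (((Submonoid.pi Set.univ (fun w : PlacesOver L v => (w.1.adicCompletionIntegers L).toSubring.toSubmonoid)).units.prod (⊤ : Subgroup ↥(normOneUnits (conjLocal L (IsCMField.complexConj L) v)))) : Subgroup ((UnitaryGroup.LocalRing L v)ˣ × ↥(normOneUnits (conjLocal L (IsCMField.complexConj L) v)))) := reflect_not_mem_torusCompactPart L v hns hu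
    have key : ∀ x : ((UnitaryGroup.LocalRing L v)ˣ × ↥(normOneUnits (conjLocal L (IsCMField.complexConj L) v))), x ∉ (((Submonoid.pi Set.univ (fun w : PlacesOver L v => (w.1.adicCompletionIntegers L).toSubring.toSubmonoid)).units.prod (⊤ : Subgroup ↥(normOneUnits (conjLocal L (IsCMField.complexConj L) v)))) : Subgroup ((UnitaryGroup.LocalRing L v)ˣ × ↥(normOneUnits (conjLocal L (IsCMField.complexConj L) v)))) →
        F0P3cStCharTSTorusDefs.torusChart L v m ∉
          {t' : ↥(cmBorelTriple L 3 v).M | (F0P3cStCharTSTorusDefs.torusChart L v x)⁻¹ * t' ∈ (CT : Set ↥(cmBorelTriple L 3 v).M)} := by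
      intro x hx hmem
      rw [Set.mem_setOf_eq, F0P3cStCharTSHShellGlue.torusChart_inv_mul_mem_iff] at hmem
      have hcoset : m ∈ x • ((CT.comap (F0P3cStCharTSTorusDefs.torusChartHom L v) : Subgroup ((UnitaryGroup.LocalRing L v)ˣ × ↥(normOneUnits (conjLocal L (IsCMField.complexConj L) v)))) : Set ((UnitaryGroup.LocalRing L v)ˣ × ↥(normOneUnits (conjLocal L (IsCMField.complexConj L) v)))) := by
        rw [mem_leftCoset_iff]; exact hmem
      exact F0P3cStCharTSShellWeight.vanDijkWeight_torusChart_ne_zero L v hns m (not_mem_torusCompactPart_of_mem_smul L v hCle hx hcoset) hΔ0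
    rw [Set.indicator_of_notMem (key u hu), Set.indicator_of_notMem (key ((fun p : ((UnitaryGroup.LocalRing L v)ˣ × ↥(normOneUnits (conjLocal L (IsCMField.complexConj L) v))) => ((Units.map ((conjLocal L (IsCMField.complexConj L) v : UnitaryGroup.LocalRing L v →+* UnitaryGroup.LocalRing L v) : UnitaryGroup.LocalRing L v →* UnitaryGroup.LocalRing L v) p.1)⁻¹, p.2)) u) hωu), add_zero, mul_zero]

/-- **`hshell` FROM THE PRODUCER `Ψ`** — `htwo_of_psi` composed with ★ p849770 `hshell_of_twoCoset`: the `hshell` clause of ★ p849745 `shf_torusTransform_of_levelShells`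
at `(n, u)` with `C_T := (𝓘.K n).subgroupOf M_T`. [cite: Rogawski1990, §12.7 L. 12.7.1 (proof) p. 191; L. 12.7.2 (proof) pp. 193–194] -/
theorem hshell_of_psi (hns : ∀ w : PlacesOver L v, IsCMField.complexConj L • w.1 = w.1)
    [MeasurableSpace (Gqs L v)] [∀ γ : Gqs L v, MeasurableSpace (Gqs L v ⧸ Subgroup.centralizer ({γ} : Set (Gqs L v)))]
    (mQv : OrbitalMeasureFamily (Gqs L v)) [MeasurableSpace ((UnitaryGroup.LocalRing L v)ˣ × ↥(normOneUnits (conjLocal L (IsCMField.complexConj L) v)))] [BorelSpace ((UnitaryGroup.LocalRing L v)ˣ × ↥(normOneUnits (conjLocal L (IsCMField.complexConj L) v)))] (μM : Measure ((UnitaryGroup.LocalRing L v)ˣ × ↥(normOneUnits (conjLocal L (IsCMField.complexConj L) v)))) [μM.IsHaarMeasure]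
    (CT : Subgroup ↥(cmBorelTriple L 3 v).M) (hCle : (CT.comap (F0P3cStCharTSTorusDefs.torusChartHom L v) : Subgroup ((UnitaryGroup.LocalRing L v)ˣ × ↥(normOneUnits (conjLocal L (IsCMField.complexConj L) v)))) ≤ (((Submonoid.pi Set.univ (fun w : PlacesOver L v => (w.1.adicCompletionIntegers L).toSubring.toSubmonoid)).units.prod (⊤ : Subgroup ↥(normOneUnits (conjLocal L (IsCMField.complexConj L) v)))) : Subgroup ((UnitaryGroup.LocalRing L v)ˣ × ↥(normOneUnits (conjLocal L (IsCMField.complexConj L) v)))))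
    (hCω : ∀ x : ((UnitaryGroup.LocalRing L v)ˣ × ↥(normOneUnits (conjLocal L (IsCMField.complexConj L) v))), F0P3cStCharTSTorusDefs.torusChart L v x ∈ CT → F0P3cStCharTSTorusDefs.torusChart L v ((fun p : ((UnitaryGroup.LocalRing L v)ˣ × ↥(normOneUnits (conjLocal L (IsCMField.complexConj L) v))) => ((Units.map ((conjLocal L (IsCMField.complexConj L) v : UnitaryGroup.LocalRing L v →+* UnitaryGroup.LocalRing L v) : UnitaryGroup.LocalRing L v →* UnitaryGroup.LocalRing L v) p.1)⁻¹, p.2)) x) ∈ CT)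
    (u : ((UnitaryGroup.LocalRing L v)ˣ × ↥(normOneUnits (conjLocal L (IsCMField.complexConj L) v)))) (hu : u ∉ (((Submonoid.pi Set.univ (fun w : PlacesOver L v => (w.1.adicCompletionIntegers L).toSubring.toSubmonoid)).units.prod (⊤ : Subgroup ↥(normOneUnits (conjLocal L (IsCMField.complexConj L) v)))) : Subgroup ((UnitaryGroup.LocalRing L v)ˣ × ↥(normOneUnits (conjLocal L (IsCMField.complexConj L) v))))) (φ : Gqs L v → ℂ) (hφ : IsLocSmooth φ) (hφΩ : tsupport φ ⊆ F0P3cStCharTSTorusDefs.hyperbolicSet L v)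
    (Ψ : ↥(cmBorelTriple L 3 v).M → ℂ) (κ : ℂ) (hκ : κ ≠ 0)
    (hΨpt : haveI := locallyCompactSpace_cmBorelU L 3 v
      ∀ (t : ↥(cmBorelTriple L 3 v).M) (d : Fin 3 → (LocalRing L v)ˣ)
      (hd : glDiagonal 3 (LocalRing L v) d =
        ((t : ↥(unitaryGroupOfForm (conjLocal L (IsCMField.complexConj L) v) (cmLocalForm L 3 v))) : GL (Fin 3) (LocalRing L v)))
      (ha' : IsUnit ((((d 0)⁻¹ * d 1 : (LocalRing L v)ˣ) : LocalRing L v) - 1))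
      (hb' : IsUnit ((((d 0)⁻¹ * d 2 : (LocalRing L v)ˣ) : LocalRing L v) - 1)),
      Ψ t =
          ((rootDeltaChar (cmBorelTriple L 3 v).P
            ⟨(t : ↥(unitaryGroupOfForm (conjLocal L (IsCMField.complexConj L) v) (cmLocalForm L 3 v))), (cmBorelTriple L 3 v).M_le t.2⟩ : ℂˣ) : ℂ) *
        (((letI : MeasurableSpace (LocalRing L v) := borel _; haveI : BorelSpace (LocalRing L v) := ⟨rfl⟩
          haveI : SecondCountableTopology (LocalRing L v) := secondCountableTopology_localRing (E := L) v
          ((distribHaarChar (LocalRing L v) ha'.unit)⁻¹ *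
            (HeisRing.skewModulus (conjLocal L (IsCMField.complexConj L) v) (continuous_conjLocal L (IsCMField.complexConj L) v) hb'.unit
              (HeisRing.map_unit_torusCentralScalar_sub_one (conjLocal L (IsCMField.complexConj L) v) (cmLocalForm_eq_over L 3 v) t hd hb'))⁻¹ :
                ℝ≥0)) : ℝ) : ℂ)⁻¹ *
        classOrbitalIntegral mQv φ
          (ConjClasses.mk ((t : ↥(unitaryGroupOfForm (conjLocal L (IsCMField.complexConj L) v) (cmLocalForm L 3 v))) : Gqs L v)))
    (hΨtwo : Ψ = fun t => κ * ({t' : ↥(cmBorelTriple L 3 v).M | (F0P3cStCharTSTorusDefs.torusChart L v u)⁻¹ * t' ∈ (CT : Set ↥(cmBorelTriple L 3 v).M)}.indicator (fun _ => (1 : ℂ)) t +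
        {t' : ↥(cmBorelTriple L 3 v).M | (F0P3cStCharTSTorusDefs.torusChart L v ((fun p : ((UnitaryGroup.LocalRing L v)ˣ × ↥(normOneUnits (conjLocal L (IsCMField.complexConj L) v))) => ((Units.map ((conjLocal L (IsCMField.complexConj L) v : UnitaryGroup.LocalRing L v →+* UnitaryGroup.LocalRing L v) : UnitaryGroup.LocalRing L v →* UnitaryGroup.LocalRing L v) p.1)⁻¹, p.2)) u))⁻¹ * t' ∈ (CT : Set ↥(cmBorelTriple L 3 v).M)}.indicator (fun _ => (1 : ℂ)) t)) :
    ∃ φ' : Gqs L v → ℂ, IsLocSmooth φ' ∧ tsupport φ' ⊆ F0P3cStCharTSTorusDefs.hyperbolicSet L v ∧ ∃ κ' : ℂ, κ' ≠ 0 ∧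
      F0P3cStCharTSTorusDefs.torusTransform L v mQv μM φ' =
        fun m => κ' * ((u • ((CT.comap (F0P3cStCharTSTorusDefs.torusChartHom L v) : Subgroup ((UnitaryGroup.LocalRing L v)ˣ × ↥(normOneUnits (conjLocal L (IsCMField.complexConj L) v)))) : Set ((UnitaryGroup.LocalRing L v)ˣ × ↥(normOneUnits (conjLocal L (IsCMField.complexConj L) v))))).indicator (fun _ => (1 : ℂ)) m +
          (u • ((CT.comap (F0P3cStCharTSTorusDefs.torusChartHom L v) : Subgroup ((UnitaryGroup.LocalRing L v)ˣ × ↥(normOneUnits (conjLocal L (IsCMField.complexConj L) v)))) : Set ((UnitaryGroup.LocalRing L v)ˣ × ↥(normOneUnits (conjLocal L (IsCMField.complexConj L) v))))).indicator (fun _ => (1 : ℂ)) ((fun p : ((UnitaryGroup.LocalRing L v)ˣ × ↥(normOneUnits (conjLocal L (IsCMField.complexConj L) v))) => ((Units.map ((conjLocal L (IsCMField.complexConj L) v : UnitaryGroup.LocalRing L v →+* UnitaryGroup.LocalRing L v) : UnitaryGroup.LocalRing L v →* UnitaryGroup.LocalRing L v) p.1)⁻¹, p.2)) m)) :=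
  F0P3cStCharTSHShellGlue.hshell_of_twoCoset L v hns mQv μM CT hCω u φ hφ hφΩ κ hκ
    (htwo_of_psi L v hns mQv CT hCle u hu φ Ψ κ hΨpt hΨtwo)

end Summit.HodgeConjecture.HodgeConjecture.Cruxes.H413.F0P3cStCharTSHTwoOfPsi

end
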